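import Mathlib
import Summits.KontsevichZagierPeriods.KontsevichZagierPeriods.Theses.HermiteRigidity
import Literature.NumberTheory.Transcendental.KZLogCalculusProofs
import Literature.NumberTheory.Transcendental.KZSubcalculusInvariants
import Literature.NumberTheory.Transcendental.KZRelationsLE

/-!
# Sketch — crux-ideate round 1, ideator 3, crux `RealEllipticSectorKernel` (stmt-KontsevichZagierPeriods-10632)

First lemmas of the three idea cards. Status after `lean check` (rc 0, 0 errors, 0 sorries, axioms
standard):

* `ReflectionTwistTransfer`   — card `reflection-twist` — PROVED (`reflectionTwistTransfer_holds`):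
  the reflection `x ↦ −x` is ONE `changeOfVariablesRel` instance carrying the `σ′`-generators of
  `(q₂, q₃)` onto the `σ`-generators of the twist `(q₂, −q₃)`.
* `OvalHermiteStep` (statement only, the analytic rule-3 move) and `HermiteDecomposition` — card
  `abstract-oval-hermite` — `HermiteDecomposition` PROVED (`hermiteDecomposition_holds`):
  `ℚ[X] = ℚ[X]_{< deg g − 1} + D_g ℚ[X]` for every `g` of positive degree.
* `IntegerNormalFormKernel`   — card `integer-normal-form` — PROVED (`integerNormalFormKernel_holds`),
  together with the generic discharges of its bookkeeping hypotheses for scaled copies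
  (`scaledRep`, `eval_scaledRep`, `scaledRep_refine`) and the passage from the crux's five-slot
  hypothesis to `ℤ`-independence (`int_independent_of_hyp`).
-/

open Set MeasureTheory
open scoped BigOperators

namespace Summit.KontsevichZagierPeriods.KontsevichZagierPeriods.Cruxes.RealEllipticSectorKernel.SketchIdeator3

open Literature.NumberTheory.Transcendental

/-- Card `reflection-twist`, first lemma. The reflection `x ↦ −x` is ONE rule-2 move carrying the
`σ′`-generator `[ (e₂,e₁), x^m/√(−f) ]` of the cubic `(q₂, q₃)` onto the `σ`-generator
`[ (ẽ₃,ẽ₂), (−1)^m x^m/√g ]` of the twisted cubic `g = 4x³ − q₂x + q₃` (parameters `(q₂, −q₃)`,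
written with the cast `((-q₃ : ℚ) : ℝ)` so that `σt` is literally the crux's `σ` at `(q₂, −q₃)`). -/
def ReflectionTwistTransfer : Prop :=
  ∀ (q₂ q₃ : ℚ), 0 < (q₂ : ℝ) ^ 3 - 27 * (q₃ : ℝ) ^ 2 →
    let f : ℝ → ℝ := fun x => 4 * x ^ 3 - (q₂ : ℝ) * x - (q₃ : ℝ)
    let g : ℝ → ℝ := fun x => 4 * x ^ 3 - (q₂ : ℝ) * x - ((-q₃ : ℚ) : ℝ)
    let σ' : Set (Fin 1 → ℝ) := {p | f (p 0) < 0 ∧ ∃ t : ℝ, t < p 0 ∧ 0 < f t}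
    let σt : Set (Fin 1 → ℝ) := {p | 0 < g (p 0) ∧ ∃ t : ℝ, p 0 < t ∧ g t < 0}
    ∀ (m : ℕ) (r s : KZ.IntegralRep 1),
      r.domain = σ' → EqOn r.integrand (fun p => p 0 ^ m / Real.sqrt (- f (p 0))) σ' →
      s.domain = σt → EqOn s.integrand (fun p => (-1 : ℝ) ^ m * (p 0 ^ m / Real.sqrt (g (p 0)))) σt →
      KZ.of r - KZ.of s ∈ KZ.changeOfVariablesRel

/-- Sanity: the twist has the same (positive) discriminant, so the crux's own `σ`-machinery applies
to it verbatim. -/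
theorem discr_twist (q₂ q₃ : ℚ) :
    (q₂ : ℝ) ^ 3 - 27 * (((-q₃ : ℚ) : ℝ)) ^ 2 = (q₂ : ℝ) ^ 3 - 27 * (q₃ : ℝ) ^ 2 := by
  push_cast; ring

/-- Sanity: `g (−x) = −f x`, the identity behind the Jacobian-1 move. -/
theorem twist_eval (q₂ q₃ : ℚ) (x : ℝ) :
    4 * (-x) ^ 3 - (q₂ : ℝ) * (-x) - ((-q₃ : ℚ) : ℝ) = - (4 * x ^ 3 - (q₂ : ℝ) * x - (q₃ : ℝ)) := by
  push_cast; ring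

/-- Card `abstract-oval-hermite`, first lemma (the move): ONE Hermite step over ANY real oval
`(a, b)` of ANY `g ∈ ℚ[X]` (`g(a) = g(b) = 0`, `g > 0` inside): the exact form
`d(Q√g) = (Q′g + Qg′/2) dx/√g` integrates to a relation (rule 3 with base dimension `0`, band
`[a, b]`, primitive `Q√g` vanishing at both ends, then rule 1a to drop the two endpoints). -/
def OvalHermiteStep : Prop :=
  ∀ (g Q : Polynomial ℚ) (a b : ℝ), a < b →
    (g.map (algebraMap ℚ ℝ)).eval a = 0 → (g.map (algebraMap ℚ ℝ)).eval b = 0 →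
    (∀ x ∈ Ioo a b, 0 < (g.map (algebraMap ℚ ℝ)).eval x) →
    ∀ (r : KZ.IntegralRep 1), r.domain = {p | a < p 0 ∧ p 0 < b} →
      EqOn r.integrand (fun p =>
        (Polynomial.aeval (p 0) (Polynomial.derivative Q) * Polynomial.aeval (p 0) g
          + Polynomial.aeval (p 0) Q * Polynomial.aeval (p 0) (Polynomial.derivative g) / 2)
          / Real.sqrt (Polynomial.aeval (p 0) g)) r.domain →
      KZ.of r ∈ KZ.relations

/-- Card `abstract-oval-hermite`, algebraic half: the twisted derivation `D_g Q = Q′g + Qg′/2`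
raises degree by exactly `deg g − 1` with non-zero leading coefficient `(k + deg g/2)·lc g`, so every
`P` is a remainder of degree `< deg g − 1` plus an element of `D_g ℚ[X]` (degree induction; for a
cubic the remainder is `α + βX`, the Hermite normal form). -/
def HermiteDecomposition : Prop :=
  ∀ (g : Polynomial ℚ), 0 < g.natDegree → ∀ (P : Polynomial ℚ),
    ∃ (R Q : Polynomial ℚ), R.degree < ((g.natDegree - 1 : ℕ) : WithBot ℕ) ∧
      P = R + (Polynomial.derivative Q * g + Q * Polynomial.derivative g * Polynomial.C (1 / 2 : ℚ))

/-- Card `integer-normal-form`, first lemma (pure algebra over `FormalRep` + soundness): if every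
generator of `S` is congruent modulo relations to an INTEGER combination of scaled basis elements
`U N i` (value `vᵢ/N`) at some denominator `N`, denominators refine (`U N i ≡ k • U (kN) i`), and the
values `vᵢ` are `ℤ`-linearly independent, then the kernel form holds on `closure S` — with no
signed-family induction: a kernel element normalises to the literal zero of the free group. -/
def IntegerNormalFormKernel : Prop :=
  ∀ (S : Set KZ.FormalRep) (ι : Type) [Fintype ι] (v : ι → ℝ) (U : ℕ → ι → KZ.FormalRep),
    (∀ n : ι → ℤ, ∑ i, (n i : ℝ) * v i = 0 → ∀ i, n i = 0) →
    (∀ (N : ℕ) (i : ι), 0 < N → KZ.eval (U N i) = v i / N) →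
    (∀ (N k : ℕ) (i : ι), 0 < N → 0 < k → U N i - k • U (k * N) i ∈ KZ.relations) →
    (∀ s ∈ S, ∃ N : ℕ, 0 < N ∧ ∃ n : ι → ℤ, s - ∑ i, n i • U N i ∈ KZ.relations) →
    ∀ c ∈ AddSubgroup.closure S, KZ.eval c = 0 → c ∈ KZ.relations

/-- How card 3 meets the crux: the crux's five-slot real-algebraic hypothesis implies the
`ℤ`-independence of the four values `(J₀, J₁, K₀, K₁)` that `IntegerNormalFormKernel` consumes
(take `a = 0` and integer `b, c, d, e`). -/
theorem int_independent_of_hyp (J₀ J₁ K₀ K₁ : ℝ)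
    (h : ∀ a b c d e : ℝ, IsAlgebraic ℚ a → IsAlgebraic ℚ b → IsAlgebraic ℚ c → IsAlgebraic ℚ d →
      IsAlgebraic ℚ e → a + b * J₀ + c * J₁ + d * K₀ + e * K₁ = 0 →
      a = 0 ∧ b = 0 ∧ c = 0 ∧ d = 0 ∧ e = 0)
    (n : Fin 4 → ℤ) (hn : ∑ i, (n i : ℝ) * ![J₀, J₁, K₀, K₁] i = 0) : ∀ i, n i = 0 := by
  have h' := h 0 (n 0) (n 1) (n 2) (n 3) isAlgebraic_zero (isAlgebraic_int (n 0))
    (isAlgebraic_int (n 1)) (isAlgebraic_int (n 2)) (isAlgebraic_int (n 3)) (by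
      simp [Fin.sum_univ_four] at hn
      linarith)
  intro i
  fin_cases i <;> simp_all

end Summit.KontsevichZagierPeriods.KontsevichZagierPeriods.Cruxes.RealEllipticSectorKernel.SketchIdeator3

namespace Summit.KontsevichZagierPeriods.KontsevichZagierPeriods.Cruxes.RealEllipticSectorKernel.SketchIdeator3

open Literature.NumberTheory.Transcendental

/-- One scaled term: `n • U N i ≡ (n * k) • U (k * N) i` modulo relations. -/
theorem zsmul_refine {ι : Type} {U : ℕ → ι → KZ.FormalRep}
    (hdiv : ∀ (N k : ℕ) (i : ι), 0 < N → 0 < k → U N i - k • U (k * N) i ∈ KZ.relations)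
    {N k : ℕ} (hN : 0 < N) (hk : 0 < k) (n : ℤ) (i : ι) :
    n • U N i - (n * (k : ℤ)) • U (k * N) i ∈ KZ.relations := by
  have h : n • U N i - (n * (k : ℤ)) • U (k * N) i = n • (U N i - k • U (k * N) i) := by
    rw [smul_sub, mul_smul, natCast_zsmul]
  rw [h]
  exact AddSubgroup.zsmul_mem _ (hdiv N k i hN hk) n

/-- Card `integer-normal-form`: the template replacement is provable now (closure induction +
soundness of the moves); kernel elements normalise to the literal zero of the free group. -/
theorem integerNormalFormKernel_holds : IntegerNormalFormKernel := by
  intro S ι _ v U hind hval hdiv hgen c hc hc0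
  have key : ∃ N : ℕ, 0 < N ∧ ∃ n : ι → ℤ, c - ∑ i, n i • U N i ∈ KZ.relations := by
    refine AddSubgroup.closure_induction (p := fun c _ => ∃ N : ℕ, 0 < N ∧ ∃ n : ι → ℤ,
        c - ∑ i, n i • U N i ∈ KZ.relations) ?_ ?_ ?_ ?_ hc
    · exact fun x hx => hgen x hx
    · exact ⟨1, one_pos, 0, by simp [KZ.relations.zero_mem]⟩
    · rintro x y - - ⟨N₁, hN₁, n₁, hx⟩ ⟨N₂, hN₂, n₂, hy⟩
      refine ⟨N₂ * N₁, Nat.mul_pos hN₂ hN₁, fun i => n₁ i * (N₂ : ℤ) + n₂ i * (N₁ : ℤ), ?_⟩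
      have hx' : ∑ i, n₁ i • U N₁ i - ∑ i, (n₁ i * (N₂ : ℤ)) • U (N₂ * N₁) i ∈ KZ.relations := by
        rw [← Finset.sum_sub_distrib]
        exact sum_mem fun i _ => zsmul_refine hdiv hN₁ hN₂ (n₁ i) i
      have hy' : ∑ i, n₂ i • U N₂ i - ∑ i, (n₂ i * (N₁ : ℤ)) • U (N₂ * N₁) i ∈ KZ.relations := by
        rw [← Finset.sum_sub_distrib, Nat.mul_comm N₂ N₁]
        exact sum_mem fun i _ => zsmul_refine hdiv hN₂ hN₁ (n₂ i) i
      have hsplit : ∑ i, (n₁ i * (N₂ : ℤ) + n₂ i * (N₁ : ℤ)) • U (N₂ * N₁) i =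
          ∑ i, (n₁ i * (N₂ : ℤ)) • U (N₂ * N₁) i + ∑ i, (n₂ i * (N₁ : ℤ)) • U (N₂ * N₁) i := by
        simp only [add_smul, Finset.sum_add_distrib]
      have e : x + y - (∑ i, (n₁ i * (N₂ : ℤ)) • U (N₂ * N₁) i + ∑ i, (n₂ i * (N₁ : ℤ)) • U (N₂ * N₁) i)
          = (x - ∑ i, n₁ i • U N₁ i) + (y - ∑ i, n₂ i • U N₂ i)
            + ((∑ i, n₁ i • U N₁ i - ∑ i, (n₁ i * (N₂ : ℤ)) • U (N₂ * N₁) i)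
              + (∑ i, n₂ i • U N₂ i - ∑ i, (n₂ i * (N₁ : ℤ)) • U (N₂ * N₁) i)) := by
        abel
      rw [hsplit, e]
      exact add_mem (add_mem hx hy) (add_mem hx' hy')
    · rintro x - ⟨N, hN, n, hx⟩
      refine ⟨N, hN, fun i => - n i, ?_⟩
      have e : -x - ∑ i, (-n i) • U N i = -(x - ∑ i, n i • U N i) := by
        simp only [neg_smul, Finset.sum_neg_distrib]
        abel
      rw [e]
      exact neg_mem hx
  obtain ⟨N, hN, n, hrel⟩ := key
  have hsound : KZ.eval (c - ∑ i, n i • U N i) = 0 :=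
    (AddMonoidHom.mem_ker).1 (KZ.relations_le_ker_eval_holds hrel)
  have hN' : (N : ℝ) ≠ 0 := by exact_mod_cast hN.ne'
  have hsum : ∑ i, (n i : ℝ) * v i = 0 := by
    rw [map_sub, hc0, map_sum] at hsound
    simp only [map_zsmul, hval N _ hN, zsmul_eq_mul] at hsound
    have h2 : ∑ i, (n i : ℝ) * v i = N * ∑ i, (n i : ℝ) * (v i / N) := by
      rw [Finset.mul_sum]
      refine Finset.sum_congr rfl fun i _ => ?_
      field_simp
    rw [h2]
    have h3 : ∑ i, (n i : ℝ) * (v i / N) = 0 := by linarith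
    rw [h3, mul_zero]
  have hn0 : ∀ i, n i = 0 := hind n hsum
  have hz : ∑ i, n i • U N i = 0 := Finset.sum_eq_zero fun i _ => by simp [hn0 i]
  rwa [hz, sub_zero] at hrel

end Summit.KontsevichZagierPeriods.KontsevichZagierPeriods.Cruxes.RealEllipticSectorKernel.SketchIdeator3

namespace Summit.KontsevichZagierPeriods.KontsevichZagierPeriods.Cruxes.RealEllipticSectorKernel.SketchIdeator3

open Literature.NumberTheory.Transcendental

/-- `|det (−id)| = 1` on `ℝ¹`. -/
theorem abs_det_neg_id :
    |(-ContinuousLinearMap.id ℝ (Fin 1 → ℝ)).det| = 1 := by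
  have h : ((-ContinuousLinearMap.id ℝ (Fin 1 → ℝ) : (Fin 1 → ℝ) →L[ℝ] (Fin 1 → ℝ)) :
      (Fin 1 → ℝ) →ₗ[ℝ] (Fin 1 → ℝ)) = (-1 : ℝ) • LinearMap.id := by
    ext x i
    simp
  change |LinearMap.det ((-ContinuousLinearMap.id ℝ (Fin 1 → ℝ) : (Fin 1 → ℝ) →L[ℝ] (Fin 1 → ℝ)) :
      (Fin 1 → ℝ) →ₗ[ℝ] (Fin 1 → ℝ))| = 1
  rw [h, LinearMap.det_smul, LinearMap.det_id, Module.finrank_fin_fun]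
  norm_num

/-- Card `reflection-twist`: the reflection move is kernel-checked — ONE instance of rule 2. -/
theorem reflectionTwistTransfer_holds : ReflectionTwistTransfer := by
  intro q₂ q₃ _hΔ f g σ' σt m r s hr hri hs hsi
  set L : (Fin 1 → ℝ) →L[ℝ] (Fin 1 → ℝ) := -ContinuousLinearMap.id ℝ (Fin 1 → ℝ) with hL
  have hLapply : ∀ x, L x = -x := fun x => by simp [hL]
  have hfg : ∀ x : ℝ, g (-x) = - f x := fun x => by simp only [f, g]; push_cast; ring
  have hgf : ∀ x : ℝ, f (-x) = - g x := fun x => by simp only [f, g]; push_cast; ring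
  -- the twisted oval is the reflected oval
  have hmem : ∀ p : Fin 1 → ℝ, p ∈ σt ↔ -p ∈ σ' := by
    intro p
    simp only [σt, σ', mem_setOf_eq, Pi.neg_apply, hgf]
    constructor
    · rintro ⟨h1, t, ht, hgt⟩
      refine ⟨by linarith, -t, by linarith, ?_⟩
      rw [hgf]; linarith
    · rintro ⟨h1, t, ht, hft⟩
      refine ⟨by linarith, -t, by linarith, ?_⟩
      rw [hfg]; linarith
  have himage : s.domain = L '' r.domain := by
    rw [hs, hr]
    ext p
    simp only [mem_image, hLapply]
    constructor
    · intro hp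
      exact ⟨-p, (hmem p).1 hp, neg_neg p⟩
    · rintro ⟨x, hx, rfl⟩
      exact (hmem (-x)).2 (by simpa using hx)
  have hLsa : IsSemialgebraicMapOn ℚ r.domain L := by
    refine (isSemialgebraicMapOn_aeval r.isSemialgebraic_domain fun j => -MvPolynomial.X j).congr
      fun x _ => ?_
    rw [hLapply]
    ext j
    simp
  have hLinj : InjOn L r.domain := fun x _ y _ hxy => by simpa [hLapply] using hxy
  have hdet : |L.det| = 1 := by rw [hL]; exact abs_det_neg_id
  refine ⟨1, r, s, L, fun _ => L, hLsa, fun _ _ => L.hasFDerivWithinAt, hLinj, himage,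
    fun x hx => ?_, rfl⟩
  have hx' : x ∈ σ' := hr ▸ hx
  have hLx : L x ∈ σt := (hmem (L x)).2 (by simpa [hLapply] using hx')
  rw [hri hx', hsi hLx, hdet, mul_one]
  simp only [hLapply, Pi.neg_apply, hfg]
  rw [← mul_div_assoc, ← mul_pow, neg_one_mul, neg_neg]

end Summit.KontsevichZagierPeriods.KontsevichZagierPeriods.Cruxes.RealEllipticSectorKernel.SketchIdeator3

namespace Summit.KontsevichZagierPeriods.KontsevichZagierPeriods.Cruxes.RealEllipticSectorKernel.SketchIdeator3

open Literature.NumberTheory.Transcendental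

/-- Card `integer-normal-form`: the scaled basis copies `[σ, b/N]` (`KZ.IntegralRep.constMul` by the
rational `N⁻¹`). -/
noncomputable def scaledRep {n : ℕ} (b : KZ.IntegralRep n) (N : ℕ) : KZ.IntegralRep n :=
  b.constMul ((N : ℝ)⁻¹) (IsAlgebraic.inv_iff.mpr (isAlgebraic_nat N))

/-- Hypothesis `hval` of `IntegerNormalFormKernel` for the scaled copies. -/
theorem eval_scaledRep {n : ℕ} (b : KZ.IntegralRep n) (N : ℕ) :
    KZ.eval (KZ.of (scaledRep b N)) = b.value / N := by
  rw [KZ.eval_of, scaledRep, KZ.IntegralRep.value_constMul, div_eq_inv_mul]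

/-- Hypothesis `hdiv` of `IntegerNormalFormKernel` for the scaled copies: denominators refine by
integrand additivity alone (`of_constMul_nat_sub_nsmul_mem_relations` + congruence). -/
theorem scaledRep_refine {n : ℕ} (b : KZ.IntegralRep n) {N k : ℕ} (hN : 0 < N) (hk : 0 < k) :
    KZ.of (scaledRep b N) - k • KZ.of (scaledRep b (k * N)) ∈ KZ.relations := by
  have h1 := (scaledRep b (k * N)).of_constMul_nat_sub_nsmul_mem_relations k
  have h2 : KZ.of (scaledRep b N)
      - KZ.of ((scaledRep b (k * N)).constMul (k : ℝ) (isAlgebraic_nat k)) ∈ KZ.relations := by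
    refine KZ.of_sub_of_mem_relations_of_eqOn (by simp [scaledRep]) fun x _ => ?_
    have hk' : (k : ℝ) ≠ 0 := by exact_mod_cast hk.ne'
    have hN' : (N : ℝ) ≠ 0 := by exact_mod_cast hN.ne'
    simp only [scaledRep, KZ.IntegralRep.integrand_constMul, Nat.cast_mul]
    field_simp
  have e : KZ.of (scaledRep b N) - k • KZ.of (scaledRep b (k * N))
      = (KZ.of (scaledRep b N) - KZ.of ((scaledRep b (k * N)).constMul (k : ℝ) (isAlgebraic_nat k)))
        + (KZ.of ((scaledRep b (k * N)).constMul (k : ℝ) (isAlgebraic_nat k))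
            - k • KZ.of (scaledRep b (k * N))) := by
    abel
  rw [e]
  exact add_mem h2 h1

end Summit.KontsevichZagierPeriods.KontsevichZagierPeriods.Cruxes.RealEllipticSectorKernel.SketchIdeator3

namespace Summit.KontsevichZagierPeriods.KontsevichZagierPeriods.Cruxes.RealEllipticSectorKernel.SketchIdeator3

open Polynomial

/-- Coefficients of the twisted derivative of a monomial, `D_g (X^k) = k X^{k-1} g + X^k g′/2`. -/
theorem coeff_twistedDeriv_X_pow (g : ℚ[X]) (k j : ℕ) :
    (derivative (X ^ k) * g + X ^ k * derivative g * C (1 / 2 : ℚ)).coeff j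
      = (k : ℚ) * (if k - 1 ≤ j then g.coeff (j - (k - 1)) else 0)
        + (if k ≤ j then g.coeff (j - k + 1) * ((j - k : ℕ) + 1 : ℚ) else 0) * (1 / 2 : ℚ) := by
  rw [derivative_X_pow, mul_assoc, coeff_add, coeff_C_mul, coeff_X_pow_mul', coeff_mul_C,
    coeff_X_pow_mul', coeff_derivative]

/-- Card `abstract-oval-hermite`, algebraic half, PROVED: `ℚ[X] = ℚ[X]_{<deg g-1} + D_g ℚ[X]`
(degree induction on the leading term, `D_g (X^k)` having degree `k + deg g − 1` and leading
coefficient `lc(g)·(k + deg g/2) ≠ 0`). -/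
theorem hermiteDecomposition_holds : HermiteDecomposition := by
  intro g hd
  set d := g.natDegree with hd_def
  have hg0 : g ≠ 0 := by
    rintro rfl
    simp [hd_def] at hd
  have hlc : g.leadingCoeff ≠ 0 := leadingCoeff_ne_zero.mpr hg0
  have hlcd : g.coeff d = g.leadingCoeff := by rw [hd_def, coeff_natDegree]
  have hcast : ((d - 1 : ℕ) : ℚ) + 1 = d := by
    rw [← Nat.cast_add_one, Nat.sub_add_cancel hd]
  -- the twisted derivation and its linearity
  set D : ℚ[X] → ℚ[X] := fun Q => derivative Q * g + Q * derivative g * C (1 / 2 : ℚ) with hD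
  have hD_add : ∀ Q₁ Q₂, D (Q₁ + Q₂) = D Q₁ + D Q₂ := by
    intro Q₁ Q₂; simp only [hD, derivative_add]; ring
  have hD_smul : ∀ (a : ℚ) Q, D (C a * Q) = C a * D Q := by
    intro a Q; simp only [hD, derivative_mul, derivative_C, zero_mul, zero_add]; ring
  -- top coefficient and vanishing above, for `D (X^k)`
  have hcoeff_top : ∀ k : ℕ, (D (X ^ k)).coeff (k + d - 1) = g.leadingCoeff * ((k : ℚ) + (d : ℚ) / 2) := by
    intro k
    simp only [hD]
    rw [coeff_twistedDeriv_X_pow, if_pos (by omega), if_pos (by omega)]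
    rcases Nat.eq_zero_or_pos k with rfl | hk
    · have e1 : 0 + d - 1 - 0 + 1 = d := by omega
      have e2 : 0 + d - 1 - 0 = d - 1 := by omega
      rw [e1, e2, hcast, hlcd]
      push_cast
      ring
    · have e1 : k + d - 1 - (k - 1) = d := by omega
      have e2 : k + d - 1 - k = d - 1 := by omega
      rw [e1, e2, Nat.sub_add_cancel hd, hcast, hlcd]
      ring
  have hcoeff_gt : ∀ k j : ℕ, k + d - 1 < j → (D (X ^ k)).coeff j = 0 := by
    intro k j hj
    simp only [hD]
    rw [coeff_twistedDeriv_X_pow, if_pos (by omega), if_pos (by omega)]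
    have h2 : g.coeff (j - k + 1) = 0 := coeff_eq_zero_of_natDegree_lt (by omega)
    rcases Nat.eq_zero_or_pos k with rfl | hk
    · rw [h2]; simp
    · have h1 : g.coeff (j - (k - 1)) = 0 := coeff_eq_zero_of_natDegree_lt (by omega)
      rw [h1, h2]; simp
  -- induction on the degree of `P`
  intro P
  induction P using WellFounded.induction Polynomial.degree_lt_wf with
  | _ P ih =>
    by_cases hP : P.degree < ((d - 1 : ℕ) : WithBot ℕ)
    · exact ⟨P, 0, hP, by simp⟩
    · have hP0 : P ≠ 0 := by
        rintro rfl
        exact hP (by rw [degree_zero]; exact WithBot.bot_lt_coe _)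
      set N := P.natDegree with hN
      have hdegP : P.degree = N := degree_eq_natDegree hP0
      have hNd : d - 1 ≤ N := by
        rw [not_lt, hdegP] at hP
        exact_mod_cast hP
      set k := N - (d - 1) with hk
      have hkN : k + d - 1 = N := by omega
      set c : ℚ := g.leadingCoeff * ((k : ℚ) + (d : ℚ) / 2) with hc
      have hkd : (0 : ℚ) < (k : ℚ) + (d : ℚ) / 2 := by positivity
      have hc0 : c ≠ 0 := mul_ne_zero hlc hkd.ne'
      set a : ℚ := P.leadingCoeff / c with ha
      set P₁ := P - C a * D (X ^ k) with hP₁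
      have hdeg₁ : P₁.degree < P.degree := by
        rw [hdegP, degree_lt_iff_coeff_zero]
        intro j hj
        rw [hP₁, coeff_sub, coeff_C_mul]
        rcases hj.lt_or_eq with hlt | heq
        · rw [hcoeff_gt k j (by omega), mul_zero, sub_zero]
          exact coeff_eq_zero_of_natDegree_lt hlt
        · rw [← heq, ← hkN, hcoeff_top k, hkN, ← hc, ha, div_mul_cancel₀ _ hc0, hN,
            coeff_natDegree, sub_self]
      obtain ⟨R, Q₁, hR, hPQ⟩ := ih P₁ hdeg₁
      refine ⟨R, Q₁ + C a * X ^ k, hR, ?_⟩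
      have key : P = P₁ + C a * D (X ^ k) := by rw [hP₁]; ring
      rw [key, hPQ]
      simp only [hD, derivative_add, derivative_mul, derivative_C, zero_mul, zero_add]
      ring

end Summit.KontsevichZagierPeriods.KontsevichZagierPeriods.Cruxes.RealEllipticSectorKernel.SketchIdeator3
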